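import Summits.Ventures.CertifiedManyBodySolver.Downfold.EmeryShapeWindowClosure
import Summits.Ventures.CertifiedManyBodySolver.Downfold.EmeryFermiScalePointsHg1201P10VirtualCorners
import HarnessLib

/-!
# THE ONE-BAND FERMI-SURFACE SHAPE `t′/t` OF THE WHOLE TYPED 3BE BOX `emeryBoxHg1201P10 (EmeryBoxesPressure)` FROM TWO VIRTUAL CORNERS (two-ray rule + window closure, §B.86;
# router/EMERY-SHAPE-CORNERS.tsv)

Venture CertifiedManyBodySolver, cell `pub/hubbard-downfold` (stage S1; INFLATION-RULES-3to1-B §B.86 (i)), seat hubbard-downfold-mod-4 (technique B, g35); namespace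
`Summit.Ventures.CertifiedManyBodySolver.Downfold.Emery`. Everything PROVED (0 sorry). WHAT THIS IS NOT: a statement about HgBa₂CuO₄ @10 GPa (box #19 @10) — the typed box is SCREENING-GRADE (its file's
grade line); `U = 0` one-body kinematics of the σ model (object E = the EXACT `t–t′` shape of the σ Fermi surface, `EmeryFermiSurfaceShape`); no interaction, no `t″`.

For EVERY one-body row `(Δ, t_pd, t_pp, t_pp′) ∈ [23/20, 5/2] × [139/100, 77/50] × [17/25, 79/100] × [289/2500, 289/2500]` eV and the fillings below, the one-band `t′/t` of the σ-model Fermi surface AT THAT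
ROW'S OWN FERMI ENERGY lies in the window of the table (device: `EmeryShapeTwoRayRule` + `EmeryShapeWindowClosure`, exactly as `EmeryBoxesLa214ShapeCorners`; virtual corners
`V_lo = (1.15, 1.39, 0.79, 0.1343)`, `V_hi = (2.5, 1.54, 0.68, 0.0995)`, t_pp′ outside the typed range by the factor b₂/b₁ = 1.162 — the explicit 3 → 1 inflation, zero iff the box is pure or of fixed
t_pp′/t_pp ratio; certificates `EmeryFermiScalePointsHg1201P10VirtualCorners`).

| filling | certified window for t′/t over the WHOLE box | V_lo ε_F bracket | V_hi ε_F bracket | lower closure | EMERY-FS-WINDOWS (g19 sub-box device) | object-E row of record [float] |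
|---|---|---|---|---|---|---|
| n_H = 1.125 (ν = 7/16) | **[-0.3201, -0.242]** | [2.2646, 2.2796] eV | [2.0278, 2.0428] eV | monotone: L = fsRatio(V_lo; e₁) | [-0.3222,-0.2425] (n_H band) | [-0.57,-0.46] (P = 0 row) |
| n_H = 1.16 (ν = 21/50) | **[-0.3206, -0.2424]** | [2.215, 2.23] eV | [1.9932, 2.0032] eV | monotone: L = fsRatio(V_lo; e₁) | [-0.3222,-0.2425] (n_H band) | [-0.57,-0.46] (P = 0 row) |

Sources: three-band model [HybertsenSchluterChristensen1989, Eq. (1)]; [AndersenEtAl1995, §6]; box rows as cited in the typed object's file.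
-/

noncomputable section

namespace Summit.Ventures.CertifiedManyBodySolver.Downfold.Emery

open Real Set

/-- **n_H = 1.125 (ν = 7/16): for every row of the box the one-band Fermi-surface `t′/t` (object E, at the row's own Fermi energy) lies in `[-0.3201, -0.242]`.** Lower closure: monotone; upper: monotone. [folklore] -/
theorem hg1201P10Box_fsRatio_nH1125 {Δ a b c : ℝ} (hΔ : Δ ∈ Icc ((23 : ℝ) / 20) ((5 : ℝ) / 2)) (ha : a ∈ Icc ((139 : ℝ) / 100) ((77 : ℝ) / 50)) (hb : b ∈ Icc ((17 : ℝ) / 25) ((79 : ℝ) / 100)) (hc : c ∈ Icc ((289 : ℝ) / 2500) ((289 : ℝ) / 2500)) :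
    fsRatio Δ a b c (fermiEnergyOf Δ a b c ((7 : ℝ) / 16)) ∈ Icc ((-3201 : ℝ) / 10000) ((-121 : ℝ) / 500) := by
  have hV : ((289 : ℝ) / 2500) * ((79 : ℝ) / 100) / ((17 : ℝ) / 25) = ((1343 : ℝ) / 10000) := by norm_num
  have hW : ((289 : ℝ) / 2500) * ((17 : ℝ) / 25) / ((79 : ℝ) / 100) = ((4913 : ℝ) / 49375) := by norm_num
  have hVlo := (fermiEnergyOf_of_pointBracketCheck virtPt_Hg1201P10Vlo_nH1125_br (by norm_num) (by norm_num) (by norm_num) (ν := (7/16 : ℝ)) (by push_cast; exact ⟨le_rfl, le_rfl⟩)).2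
  have hVhi := (fermiEnergyOf_of_pointBracketCheck virtPt_Hg1201P10Vhi_nH1125_br (by norm_num) (by norm_num) (by norm_num) (ν := (7/16 : ℝ)) (by push_cast; exact ⟨le_rfl, le_rfl⟩)).2
  have hAlo := (fermiEnergyOf_of_pointBracketCheck virtPt_Hg1201P10Alo_nH1125_br (by norm_num) (by norm_num) (by norm_num) (ν := (7/16 : ℝ)) (by push_cast; exact ⟨le_rfl, le_rfl⟩)).2
  have hTop := (fermiEnergyOf_of_pointBracketCheck virtPt_Hg1201P10H_nH1125_br (by norm_num) (by norm_num) (by norm_num) (ν := (7/16 : ℝ)) (by push_cast; exact ⟨le_rfl, le_rfl⟩)).2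
  push_cast at hVlo hVhi hAlo hTop
  norm_num at hVlo hVhi hAlo hTop
  refine fsRatio_fermiEnergyOf_mem_Icc_windowClosure (Δ₁ := ((23 : ℝ) / 20)) (Δ₂ := ((5 : ℝ) / 2)) (a₁ := ((139 : ℝ) / 100)) (a₂ := ((77 : ℝ) / 50)) (b₁ := ((17 : ℝ) / 25))
    (b₂ := ((79 : ℝ) / 100)) (c₁ := ((289 : ℝ) / 2500)) (c₂ := ((289 : ℝ) / 2500)) (e₁ := ((11323 : ℝ) / 5000)) (e₂ := ((5751 : ℝ) / 2500)) (e₃ := 0) (e₄ := ((5107 : ℝ) / 2500)) (by norm_num) (by norm_num) (by norm_num) (by norm_num)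
    (by norm_num) hΔ ha hb hc (by norm_num) (by norm_num) ?_ ?_ ?_ (by norm_num) ?_ ?_ ?_ (by norm_num) ?_
  · -- regime at the box's Fermi-energy high corner: c₂ b₂ ε_F(Δ₁, a₂, b₂, c₁) ≤ a₁² b₁
    nlinarith [hTop.2]
  · rw [hV]; exact hVlo.1
  · exact hAlo.2
  · intro ε hε
    rw [hV]
    have hmono := (fsRatio_mem_Icc_on_window_of_dopingDisc_nonpos (Δ := ((23 : ℝ) / 20)) (a := ((139 : ℝ) / 100)) (b := ((79 : ℝ) / 100)) (c := ((1343 : ℝ) / 10000))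
      (p := ((11323 : ℝ) / 5000)) (q := ((5751 : ℝ) / 2500)) (by norm_num) (by norm_num) (by norm_num) (by norm_num) (by norm_num) (by norm_num) (by norm_num)
      (by norm_num [dopingDisc]) hε).1
    refine le_trans ?_ hmono
    norm_num [fsRatio, fsD, fsN]
  · exact (fermiEnergyOf_pos (by norm_num) (by norm_num) (by norm_num) (by norm_num) (by norm_num) (by norm_num)).le
  · rw [hW]; exact hVhi.2
  · intro ε hε
    rw [hW]
    have hmono := (fsRatio_mem_Icc_on_window_of_dopingDisc_nonpos (Δ := ((5 : ℝ) / 2)) (a := ((77 : ℝ) / 50)) (b := ((17 : ℝ) / 25)) (c := ((4913 : ℝ) / 49375))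
      (p := 0) (q := ((5107 : ℝ) / 2500)) (by norm_num) (by norm_num) (by norm_num) (by norm_num) (by norm_num) (by norm_num) (by norm_num)
      (by norm_num [dopingDisc]) hε).2
    refine le_trans hmono ?_
    norm_num [fsRatio, fsD, fsN]

/-- **n_H = 1.16 (ν = 21/50): for every row of the box the one-band Fermi-surface `t′/t` (object E, at the row's own Fermi energy) lies in `[-0.3206, -0.2424]`.** Lower closure: monotone; upper: monotone. [folklore] -/
theorem hg1201P10Box_fsRatio_nH116 {Δ a b c : ℝ} (hΔ : Δ ∈ Icc ((23 : ℝ) / 20) ((5 : ℝ) / 2)) (ha : a ∈ Icc ((139 : ℝ) / 100) ((77 : ℝ) / 50)) (hb : b ∈ Icc ((17 : ℝ) / 25) ((79 : ℝ) / 100)) (hc : c ∈ Icc ((289 : ℝ) / 2500) ((289 : ℝ) / 2500)) :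
    fsRatio Δ a b c (fermiEnergyOf Δ a b c ((21 : ℝ) / 50)) ∈ Icc ((-1603 : ℝ) / 5000) ((-303 : ℝ) / 1250) := by
  have hV : ((289 : ℝ) / 2500) * ((79 : ℝ) / 100) / ((17 : ℝ) / 25) = ((1343 : ℝ) / 10000) := by norm_num
  have hW : ((289 : ℝ) / 2500) * ((17 : ℝ) / 25) / ((79 : ℝ) / 100) = ((4913 : ℝ) / 49375) := by norm_num
  have hVlo := (fermiEnergyOf_of_pointBracketCheck virtPt_Hg1201P10Vlo_nH116_br (by norm_num) (by norm_num) (by norm_num) (ν := (21/50 : ℝ)) (by push_cast; exact ⟨le_rfl, le_rfl⟩)).2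
  have hVhi := (fermiEnergyOf_of_pointBracketCheck virtPt_Hg1201P10Vhi_nH116_br (by norm_num) (by norm_num) (by norm_num) (ν := (21/50 : ℝ)) (by push_cast; exact ⟨le_rfl, le_rfl⟩)).2
  have hAlo := (fermiEnergyOf_of_pointBracketCheck virtPt_Hg1201P10Alo_nH116_br (by norm_num) (by norm_num) (by norm_num) (ν := (21/50 : ℝ)) (by push_cast; exact ⟨le_rfl, le_rfl⟩)).2
  have hTop := (fermiEnergyOf_of_pointBracketCheck virtPt_Hg1201P10H_nH116_br (by norm_num) (by norm_num) (by norm_num) (ν := (21/50 : ℝ)) (by push_cast; exact ⟨le_rfl, le_rfl⟩)).2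
  push_cast at hVlo hVhi hAlo hTop
  norm_num at hVlo hVhi hAlo hTop
  refine fsRatio_fermiEnergyOf_mem_Icc_windowClosure (Δ₁ := ((23 : ℝ) / 20)) (Δ₂ := ((5 : ℝ) / 2)) (a₁ := ((139 : ℝ) / 100)) (a₂ := ((77 : ℝ) / 50)) (b₁ := ((17 : ℝ) / 25))
    (b₂ := ((79 : ℝ) / 100)) (c₁ := ((289 : ℝ) / 2500)) (c₂ := ((289 : ℝ) / 2500)) (e₁ := ((443 : ℝ) / 200)) (e₂ := ((22497 : ℝ) / 10000)) (e₃ := 0) (e₄ := ((1252 : ℝ) / 625)) (by norm_num) (by norm_num) (by norm_num) (by norm_num)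
    (by norm_num) hΔ ha hb hc (by norm_num) (by norm_num) ?_ ?_ ?_ (by norm_num) ?_ ?_ ?_ (by norm_num) ?_
  · -- regime at the box's Fermi-energy high corner: c₂ b₂ ε_F(Δ₁, a₂, b₂, c₁) ≤ a₁² b₁
    nlinarith [hTop.2]
  · rw [hV]; exact hVlo.1
  · exact hAlo.2
  · intro ε hε
    rw [hV]
    have hmono := (fsRatio_mem_Icc_on_window_of_dopingDisc_nonpos (Δ := ((23 : ℝ) / 20)) (a := ((139 : ℝ) / 100)) (b := ((79 : ℝ) / 100)) (c := ((1343 : ℝ) / 10000))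
      (p := ((443 : ℝ) / 200)) (q := ((22497 : ℝ) / 10000)) (by norm_num) (by norm_num) (by norm_num) (by norm_num) (by norm_num) (by norm_num) (by norm_num)
      (by norm_num [dopingDisc]) hε).1
    refine le_trans ?_ hmono
    norm_num [fsRatio, fsD, fsN]
  · exact (fermiEnergyOf_pos (by norm_num) (by norm_num) (by norm_num) (by norm_num) (by norm_num) (by norm_num)).le
  · rw [hW]; exact hVhi.2
  · intro ε hε
    rw [hW]
    have hmono := (fsRatio_mem_Icc_on_window_of_dopingDisc_nonpos (Δ := ((5 : ℝ) / 2)) (a := ((77 : ℝ) / 50)) (b := ((17 : ℝ) / 25)) (c := ((4913 : ℝ) / 49375))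
      (p := 0) (q := ((1252 : ℝ) / 625)) (by norm_num) (by norm_num) (by norm_num) (by norm_num) (by norm_num) (by norm_num) (by norm_num)
      (by norm_num [dopingDisc]) hε).2
    refine le_trans hmono ?_
    norm_num [fsRatio, fsD, fsN]

end Summit.Ventures.CertifiedManyBodySolver.Downfold.Emery
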